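import Summits.NavierStokesRegularity.NavierStokesRegularity.Theorems.SwirlFreeBudgetEtaTenThirds
import Summits.NavierStokesRegularity.NavierStokesRegularity.Theorems.SwirlFreeBudgetEtaProfiles
import Mathlib.MeasureTheory.Integral.DominatedConvergence
import HarnessLib

/-!
# SwirlFreeBudget, crux K-18.1 `EtaMoserBound`, step A.5: the reverse Hölder step for the
# scalar family `f = ω_θ/r` at a fixed regularisation `λ` (seat nsreg-p4 g13)

Support file for the DORMANT route `SwirlThreshold` (crux stmt-NavierStokesRegularity-2002) and
planner nsreg-p2's ROUND-18 Appendix A (`R18-APPENDIX-EtaMoser.md`, (A.5) = Chen–Tsai–Zhang 2022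
(eqA.6) with `Γ ↦ η`).  For the abstract `η`-family of the siblings (a field `W` and a scalar
family `f` on `]lo, hi[`, globally smooth axisymmetric slices, `W` divergence free on an open
`U`, the classical equation `∂ₜf = Δf − Df[W] + 2 radDerivQuot f` at the points of `U`) and an
axis point `c` with `B̄(c, ϱ') ⊆ U`, `R₂/2 ≤ ϱ < ϱ' ≤ R₂`, `∫_{B̄(c,ϱ')} |W(s)|² ≤ w̄` on
`[t₁ − ϱ'², t₁[`, and real `m ≥ 1`:

* `sliceEnergy_le_of_Ico` — a bound for `∫_K ‖W(s)‖²` on `[a, t[` extends to `s = t` by continuity;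
* `tenThirds_rhs_pack` — `C_S² (ofReal r)^{2/3} (5 ofReal r) ≤ ofReal (5 C_S² r'^{5/3})` for `r ≤ r'`;
* `eta_reverseHolder_lambda` — **the step at fixed `λ`**: for an admissible profile `H = s²` with
  `|v|^m ≤ s(v)`, cut-offs equal to `1` on the inner cylinder `]t₁−ϱ², t₁[ × B(c,ϱ)` and supported in
  `[T₀, t₁] × K ⊆ Q((t₁,c), ϱ')`, and `18B² + 1728 B⁴C_S⁶w̄² + 2Q + C_χ ≤ K′`:
  `∬_{Q_ϱ} |f|^{10m/3} ≤ ofReal (5 C_S² (K′ ∬_{Q_{ϱ'}} H(f))^{5/3})`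
  (`eta_tenThirds_le`; on the inner cylinder the integrand is `s(f)^{10/3} ≥ |f|^{10m/3}`; the mass
  `∫(𝒦χ + |χ'|) m ≤ K′ ∬_{Q_{ϱ'}} H(f)` by Fubini).

WHAT THIS IS NOT: not NS regularity — an estimate for the smooth swirl-free class; `EtaMoserBound`
stays OPEN here; no crux claim.
-/

-- the problem directory repeats the summit name (D-0017); core's `dupNamespace` linter fires
set_option linter.dupNamespace false

namespace Summit.NavierStokesRegularity.NavierStokesRegularity.Theorems.SwirlFreeBudget

open MeasureTheory Set Filter Topology Metric Function intervalIntegral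
open scoped RealInnerProductSpace Laplacian ContDiff ENNReal NNReal
open Literature.Analysis Literature.Analysis.FluidPDE Literature.Analysis.FluidPDE.Seregin2020

noncomputable section

section Core

variable {W : ℝ → EuclideanSpace ℝ (Fin 3) → EuclideanSpace ℝ (Fin 3)}
  {f : ℝ → EuclideanSpace ℝ (Fin 3) → ℝ} {lo hi : ℝ}

/-- **A bound on `[a, t[` for the slice energy `∫_K ‖W(s)‖²` extends to `s = t`** when `W` is
jointly continuous on `]lo, hi[ × ℝ³ ∋ {t} × K` (`K` compact): the slice energy is continuous in
`s` (parametric integral over a compact set). -/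
theorem sliceEnergy_le_of_Ico
    (hWc : ContinuousOn (fun p : ℝ × EuclideanSpace ℝ (Fin 3) => W p.1 p.2) (Ioo lo hi ×ˢ univ))
    {K : Set (EuclideanSpace ℝ (Fin 3))} (hK : IsCompact K) {a t : ℝ} (ha : lo < a) (hat : a < t)
    (ht : t < hi) {wbar : ℝ} (h : ∀ s ∈ Ico a t, ∫ x in K, ‖W s x‖ ^ 2 ≤ wbar) :
    ∫ x in K, ‖W t x‖ ^ 2 ≤ wbar := by
  obtain ⟨b, htb, hb⟩ := exists_between ht
  have hab : a ≤ b := (hat.trans htb).le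
  have hIcc : Icc a b ⊆ Ioo lo hi := fun r hr => ⟨lt_of_lt_of_le ha hr.1, lt_of_le_of_lt hr.2 hb⟩
  -- a globally continuous integrand agreeing with `‖W‖²` for `s ∈ [a, b]`
  set F : ℝ → EuclideanSpace ℝ (Fin 3) → ℝ := fun s x => ‖W (projIcc a b hab s) x‖ ^ 2 with hF
  have hFc : Continuous (uncurry F) := by
    have hπ : Continuous fun q : ℝ × EuclideanSpace ℝ (Fin 3) => ((projIcc a b hab q.1 : ℝ), q.2) :=
      (continuous_subtype_val.comp (continuous_projIcc.comp continuous_fst)).prodMk continuous_snd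
    have hπm : ∀ q : ℝ × EuclideanSpace ℝ (Fin 3),
        ((projIcc a b hab q.1 : ℝ), q.2) ∈ Ioo lo hi ×ˢ (univ : Set (EuclideanSpace ℝ (Fin 3))) := fun q =>
      ⟨hIcc (projIcc a b hab q.1).2, mem_univ _⟩
    have h1 := hWc.comp_continuous hπ hπm
    exact (h1.norm.pow 2).congr fun q => rfl
  have hG : Continuous fun s => ∫ x in K, F s x :=
    continuous_parametric_integral_of_continuous hFc hK
  have hGeq : ∀ s ∈ Icc a b, (∫ x in K, F s x) = ∫ x in K, ‖W s x‖ ^ 2 := fun s hs => by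
    simp only [hF, projIcc_of_mem hab hs]
  have htI : t ∈ Icc a b := ⟨hat.le, htb.le⟩
  rw [← hGeq t htI]
  have hlim : Tendsto (fun s => ∫ x in K, F s x) (𝓝[<] t) (𝓝 (∫ x in K, F t x)) :=
    (hG.tendsto t).mono_left nhdsWithin_le_nhds
  refine le_of_tendsto hlim ?_
  filter_upwards [Ioo_mem_nhdsLT hat] with s hs
  rw [hGeq s ⟨hs.1.le, (hs.2.trans htb).le⟩]
  exact h s ⟨hs.1.le, hs.2⟩

/-- The packing of the right-hand side of `eta_tenThirds_le` into a single `ofReal`. -/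
theorem tenThirds_rhs_pack (C : ℝ≥0) {r r' : ℝ} (hr : 0 ≤ r) (hrr' : r ≤ r') :
    (C : ℝ≥0∞) ^ 2 * ENNReal.ofReal r ^ (2 / 3 : ℝ) * (5 * ENNReal.ofReal r) ≤
      ENNReal.ofReal (5 * (C : ℝ) ^ 2 * r' ^ (5 / 3 : ℝ)) := by
  have hr' : 0 ≤ r' := hr.trans hrr'
  have h1 : ENNReal.ofReal r ^ (2 / 3 : ℝ) ≤ ENNReal.ofReal (r' ^ (2 / 3 : ℝ)) := by
    rw [← ENNReal.ofReal_rpow_of_nonneg hr' (by norm_num)]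
    exact ENNReal.rpow_le_rpow (ENNReal.ofReal_le_ofReal hrr') (by norm_num)
  have h2 : 5 * ENNReal.ofReal r ≤ ENNReal.ofReal (5 * r') := by
    rw [ENNReal.ofReal_mul (by norm_num : (0 : ℝ) ≤ 5), show ENNReal.ofReal 5 = 5 by norm_num]
    exact mul_le_mul_right (ENNReal.ofReal_le_ofReal hrr') _
  have hC : (C : ℝ≥0∞) ^ 2 = ENNReal.ofReal ((C : ℝ) ^ 2) := by
    rw [ENNReal.ofReal_pow C.coe_nonneg, ENNReal.ofReal_coe_nnreal]
  calc (C : ℝ≥0∞) ^ 2 * ENNReal.ofReal r ^ (2 / 3 : ℝ) * (5 * ENNReal.ofReal r)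
      ≤ ENNReal.ofReal ((C : ℝ) ^ 2) * ENNReal.ofReal (r' ^ (2 / 3 : ℝ)) * ENNReal.ofReal (5 * r') := by
        rw [hC]; gcongr
    _ = ENNReal.ofReal ((C : ℝ) ^ 2 * r' ^ (2 / 3 : ℝ) * (5 * r')) := by
        rw [← ENNReal.ofReal_mul (sq_nonneg _), ← ENNReal.ofReal_mul (by positivity)]
    _ = ENNReal.ofReal (5 * (C : ℝ) ^ 2 * r' ^ (5 / 3 : ℝ)) := by
        congr 1
        rw [show (5 / 3 : ℝ) = 2 / 3 + 1 by norm_num, Real.rpow_add' hr' (by norm_num), Real.rpow_one]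
        ring

/-- **The reverse Hölder step at a fixed regularisation** (memo (A.5) for the profile `H = s²`).
In the abstract setting of `eta_tenThirds_le`, suppose moreover: `|v|^m ≤ s(v)`; the time factor
`χ = χ̃² ∈ [0,1]` (`χ̃ ≥ 0`) has `|χ'| ≤ C_χ` and equals `1` on `[t₁ − ϱ², ∞)`, `T₀ ≤ t₁ − ϱ²`; the space factor `ψ`
equals `1` on `B(c, ϱ)`; `K ⊆ B(c, ϱ')`, `t₁ − ϱ'² ≤ T₀`, `lo < t₁ − ϱ'²`; and
`18B² + 1728B⁴C_S⁶w̄² + 2Q + C_χ ≤ K′`.  Then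
`∬_{]t₁−ϱ²,t₁[×B(c,ϱ)} |f|^{10m/3} ≤ ofReal (5 C_S² (K′ ∬_{]t₁−ϱ'²,t₁[×B(c,ϱ')} H(f))^{5/3})`. -/
theorem eta_reverseHolder_lambda
    (hf : ∀ τ ∈ Ioo lo hi, ContDiff ℝ 2 (f τ)) (hfax : ∀ τ ∈ Ioo lo hi, IsAxisymmetricScalar (f τ))
    (hW : ∀ τ ∈ Ioo lo hi, ContDiff ℝ 1 (W τ))
    {U : Set (EuclideanSpace ℝ (Fin 3))}
    (hdiv : ∀ τ ∈ Ioo lo hi, ∀ x ∈ U, VectorCalculus.divergence (W τ) x = 0)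
    (hfc : ContinuousOn (fun p : ℝ × EuclideanSpace ℝ (Fin 3) => f p.1 p.2) (Ioo lo hi ×ˢ univ))
    (hDc : ContinuousOn (fun p : ℝ × EuclideanSpace ℝ (Fin 3) => fderiv ℝ (f p.1) p.2) (Ioo lo hi ×ˢ univ))
    (hqfc : ContinuousOn (fun p : ℝ × EuclideanSpace ℝ (Fin 3) => radDerivQuot (f p.1) p.2) (Ioo lo hi ×ˢ univ))
    (hWc : ContinuousOn (fun p : ℝ × EuclideanSpace ℝ (Fin 3) => W p.1 p.2) (Ioo lo hi ×ˢ univ))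
    (hLc : ContinuousOn (fun p : ℝ × EuclideanSpace ℝ (Fin 3) =>
      (Δ (f p.1)) p.2 - fderiv ℝ (f p.1) p.2 (W p.1 p.2) + 2 * radDerivQuot (f p.1) p.2) (Ioo lo hi ×ˢ univ))
    (heq : ∀ x ∈ U, ∀ s ∈ Ioo lo hi, ∀ t ∈ Ioo lo hi, s ≤ t →
      f t x - f s x = ∫ τ in s..t, ((Δ (f τ)) x - fderiv ℝ (f τ) x (W τ x) + 2 * radDerivQuot (f τ) x))
    {m : ℝ} (hm : 1 ≤ m)
    {H sf : ℝ → ℝ} (hH : ContDiff ℝ 2 H) (hsf : ContDiff ℝ 1 sf) (hsf0 : ∀ v, 0 ≤ sf v)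
    (hHs : ∀ v, H v = sf v ^ 2) (hs2 : ∀ v, 2 * deriv sf v ^ 2 ≤ deriv (deriv H) v)
    (hκ : ∀ v, deriv H v ^ 2 ≤ 2 * H v * deriv (deriv H) v) (hsfge : ∀ v, |v| ^ m ≤ sf v)
    {ψ Θ : EuclideanSpace ℝ (Fin 3) → ℝ} (hψ : ContDiff ℝ 1 ψ) (hψ0 : ∀ x, 0 ≤ ψ x) (hψ1 : ∀ x, ψ x ≤ 1)
    (hΘψ : ∀ x, Θ x = ψ x ^ 2) (hΘax : IsAxisymmetricScalar Θ) {B : ℝ} (hB : 0 ≤ B)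
    (hBψ : ∀ x, ‖gradient ψ x‖ ≤ B)
    {K : Set (EuclideanSpace ℝ (Fin 3))} (hK : IsCompact K) (hψK : tsupport ψ ⊆ K) (hKU : K ⊆ U)
    {q : EuclideanSpace ℝ (Fin 3) → ℝ} (hqc : Continuous q) (hqK : ∀ x, x ∉ K → q x = 0)
    (hqax : IsAxisymmetricScalar q) {Q : ℝ} (hQ : ∀ x, |q x| ≤ Q)
    (hq : ∀ x : EuclideanSpace ℝ (Fin 3), x 0 * q x = fderiv ℝ (fun y => Θ y ^ 2) x (EuclideanSpace.single 0 1))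
    {χ χt : ℝ → ℝ} (hχ : ContDiff ℝ 1 χ) (hχχt : ∀ s, χ s = χt s ^ 2) (hχt0 : ∀ s, 0 ≤ χt s)
    (hχ01 : ∀ s, 0 ≤ χ s ∧ χ s ≤ 1)
    {Cχ : ℝ} (hχ' : ∀ s, |deriv χ s| ≤ Cχ)
    {T₀ t₁ : ℝ} (h0 : lo < T₀) (h01 : T₀ < t₁) (h1 : t₁ < hi) (hχT₀ : χ T₀ = 0)
    {wbar : ℝ} (hwbar : ∀ s ∈ Icc T₀ t₁, ∫ x in K, ‖W s x‖ ^ 2 ≤ wbar)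
    {c : EuclideanSpace ℝ (Fin 3)} {ϱ ϱ' : ℝ} (hT₀a : T₀ ≤ t₁ - ϱ ^ 2)
    (hχone : ∀ s, t₁ - ϱ ^ 2 ≤ s → χ s = 1) (hψone : ∀ x ∈ ball c ϱ, ψ x = 1)
    (hT₀b : t₁ - ϱ' ^ 2 ≤ T₀) (hKball : K ⊆ ball c ϱ') (hlo : lo < t₁ - ϱ' ^ 2)
    {Kp : ℝ} (hKp0 : 0 ≤ Kp)
    (hKp : 18 * B ^ 2 + 1728 * B ^ 4 *
        (SNormLESNormFDerivOfEqConst ℝ (volume : Measure (EuclideanSpace ℝ (Fin 3))) 2 : ℝ) ^ 6 * wbar ^ 2 +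
        2 * Q + Cχ ≤ Kp) :
    ∫⁻ p in Ioo (t₁ - ϱ ^ 2) t₁ ×ˢ ball c ϱ, ‖f p.1 p.2‖ₑ ^ (10 * m / 3 : ℝ)
        ∂(volume : Measure (ℝ × EuclideanSpace ℝ (Fin 3))) ≤
      ENNReal.ofReal (5 * (SNormLESNormFDerivOfEqConst ℝ (volume : Measure (EuclideanSpace ℝ (Fin 3))) 2 : ℝ) ^ 2 *
        (Kp * ∫ p in Ioo (t₁ - ϱ' ^ 2) t₁ ×ˢ ball c ϱ', H (f p.1 p.2)
          ∂(volume : Measure (ℝ × EuclideanSpace ℝ (Fin 3)))) ^ (5 / 3 : ℝ)) := by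
  have hKc : IsClosed K := hK.isClosed
  have hH0 : ∀ v, 0 ≤ H v := fun v => by rw [hHs]; exact sq_nonneg _
  obtain ⟨mlam, hmlam⟩ : ∃ mlam : ℝ → ℝ, ∀ s, mlam s = ∫ x in K, H (f s x) := ⟨_, fun _ => rfl⟩
  -- the `L^{10/3}` bound
  have h103 := eta_tenThirds_le hf hfax hW hdiv hfc hDc hqfc hWc hLc heq hH hsf hsf0 hHs hs2 hκ hψ hψ0 hψ1
    hΘψ hΘax hB hBψ hK hψK hKU hqc hqK hqax hQ hq hχ hχχt h0 h01 h1 hχT₀ hwbar hmlam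
  -- the box `[t₁ - ϱ'², t₁] × B̄(c, ϱ')` and the outer cylinder
  have hboxI : Icc (t₁ - ϱ' ^ 2) t₁ ×ˢ closedBall c ϱ' ⊆ Ioo lo hi ×ˢ (univ : Set (EuclideanSpace ℝ (Fin 3))) :=
    prod_mono (fun r hr => ⟨hlo.trans_le hr.1, lt_of_le_of_lt hr.2 h1⟩) (subset_univ _)
  have hboxc : IsCompact (Icc (t₁ - ϱ' ^ 2) t₁ ×ˢ closedBall c ϱ') := isCompact_Icc.prod (isCompact_closedBall _ _)
  have hQ'box : Ioo (t₁ - ϱ' ^ 2) t₁ ×ˢ ball c ϱ' ⊆ Icc (t₁ - ϱ' ^ 2) t₁ ×ˢ closedBall c ϱ' :=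
    prod_mono Ioo_subset_Icc_self ball_subset_closedBall
  have hQ'm : MeasurableSet (Ioo (t₁ - ϱ' ^ 2) t₁ ×ˢ ball c ϱ') := measurableSet_Ioo.prod measurableSet_ball
  have hQm : MeasurableSet (Ioo (t₁ - ϱ ^ 2) t₁ ×ˢ ball c ϱ) := measurableSet_Ioo.prod measurableSet_ball
  have hintC : IntegrableOn (fun p : ℝ × EuclideanSpace ℝ (Fin 3) => H (f p.1 p.2))
      (Icc (t₁ - ϱ' ^ 2) t₁ ×ˢ closedBall c ϱ') (volume : Measure (ℝ × EuclideanSpace ℝ (Fin 3))) :=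
    ((hH.continuous.comp_continuousOn hfc).mono hboxI).integrableOn_compact hboxc
  -- (a) the lower bound on the inner cylinder
  have hlow : ∫⁻ p in Ioo (t₁ - ϱ ^ 2) t₁ ×ˢ ball c ϱ, ‖f p.1 p.2‖ₑ ^ (10 * m / 3 : ℝ)
        ∂(volume : Measure (ℝ × EuclideanSpace ℝ (Fin 3))) ≤
      ∫⁻ p, ‖χt p.1 * (Θ p.2 * sf (f p.1 p.2))‖ₑ ^ (10 / 3 : ℝ) ∂((volume.restrict (Ioo T₀ t₁)).prod volume) := by
    have hμ : ((volume : Measure ℝ).restrict (Ioo T₀ t₁)).prod (volume : Measure (EuclideanSpace ℝ (Fin 3))) =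
        (volume : Measure (ℝ × EuclideanSpace ℝ (Fin 3))).restrict (Ioo T₀ t₁ ×ˢ univ) := by
      rw [show (volume : Measure (ℝ × EuclideanSpace ℝ (Fin 3))) = (volume : Measure ℝ).prod volume from rfl,
        ← Measure.prod_restrict, Measure.restrict_univ]
    rw [hμ]
    have hsub : Ioo (t₁ - ϱ ^ 2) t₁ ×ˢ ball c ϱ ⊆ Ioo T₀ t₁ ×ˢ (univ : Set (EuclideanSpace ℝ (Fin 3))) :=
      prod_mono (Ioo_subset_Ioo hT₀a le_rfl) (subset_univ _)
    refine le_trans (setLIntegral_mono' hQm fun p hp => ?_) (lintegral_mono_set hsub)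
    have hχ1 : χt p.1 = 1 := by
      have h2 := hχχt p.1
      rw [hχone p.1 hp.1.1.le] at h2
      rw [← Real.sqrt_sq (hχt0 p.1), ← h2, Real.sqrt_one]
    have hΘ1 : Θ p.2 = 1 := by rw [hΘψ, hψone p.2 hp.2]; norm_num
    rw [hχ1, hΘ1, one_mul, one_mul, Real.enorm_eq_ofReal_abs, Real.enorm_eq_ofReal (hsf0 _),
      ENNReal.ofReal_rpow_of_nonneg (abs_nonneg _) (by positivity),
      ENNReal.ofReal_rpow_of_nonneg (hsf0 _) (by positivity)]
    refine ENNReal.ofReal_le_ofReal ?_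
    rw [show (10 * m / 3 : ℝ) = m * (10 / 3) by ring, Real.rpow_mul (abs_nonneg _)]
    exact Real.rpow_le_rpow (Real.rpow_nonneg (abs_nonneg _) _) (hsfge _) (by norm_num)
  -- (b) the upper bound `ℛ ≤ K′ · ∬ H(f)`
  have iim : IntervalIntegrable mlam volume T₀ t₁ := intervalIntegrable_sliceMass hfc hH.continuous hK hmlam h0 h01.le h1
  have hC0 : 0 ≤ 18 * B ^ 2 + 1728 * B ^ 4 *
      (SNormLESNormFDerivOfEqConst ℝ (volume : Measure (EuclideanSpace ℝ (Fin 3))) 2 : ℝ) ^ 6 * wbar ^ 2 + 2 * Q := by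
    have hQ0 : 0 ≤ Q := (abs_nonneg _).trans (hQ 0)
    positivity
  have hℛle : ∫ s in T₀..t₁, ((18 * B ^ 2 + 1728 * B ^ 4 *
        (SNormLESNormFDerivOfEqConst ℝ (volume : Measure (EuclideanSpace ℝ (Fin 3))) 2 : ℝ) ^ 6 * wbar ^ 2 +
        2 * Q) * χ s + |deriv χ s|) * mlam s ≤
      Kp * ∫ p in Ioo (t₁ - ϱ' ^ 2) t₁ ×ˢ ball c ϱ', H (f p.1 p.2) ∂(volume : Measure (ℝ × EuclideanSpace ℝ (Fin 3))) := by
    have hm0 : ∀ s, 0 ≤ mlam s := fun s => by rw [hmlam]; exact setIntegral_nonneg hKc.measurableSet fun x _ => hH0 _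
    have hpt : ∀ s ∈ Icc T₀ t₁, ((18 * B ^ 2 + 1728 * B ^ 4 *
        (SNormLESNormFDerivOfEqConst ℝ (volume : Measure (EuclideanSpace ℝ (Fin 3))) 2 : ℝ) ^ 6 * wbar ^ 2 +
        2 * Q) * χ s + |deriv χ s|) * mlam s ≤ Kp * mlam s := by
      intro s _
      refine mul_le_mul_of_nonneg_right ?_ (hm0 s)
      have h1 := mul_le_of_le_one_right hC0 (hχ01 s).2
      have h2 := hχ' s
      linarith
    have iiR : IntervalIntegrable (fun s => ((18 * B ^ 2 + 1728 * B ^ 4 *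
        (SNormLESNormFDerivOfEqConst ℝ (volume : Measure (EuclideanSpace ℝ (Fin 3))) 2 : ℝ) ^ 6 * wbar ^ 2 +
        2 * Q) * χ s + |deriv χ s|) * mlam s) volume T₀ t₁ :=
      iim.continuousOn_mul ((continuous_const.mul hχ.continuous).add (hχ.continuous_deriv le_rfl).abs).continuousOn
    have hI := intervalIntegral.integral_mono_on h01.le iiR (iim.const_mul Kp) hpt
    rw [intervalIntegral.integral_const_mul] at hI
    refine hI.trans (mul_le_mul_of_nonneg_left ?_ hKp0)
    -- `∫_{T₀}^{t₁} m = ∬_{]T₀,t₁[×K} H(f) ≤ ∬_{Q_{ϱ'}} H(f)`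
    have hsubQ : Ioo T₀ t₁ ×ˢ K ⊆ Ioo (t₁ - ϱ' ^ 2) t₁ ×ˢ ball c ϱ' :=
      prod_mono (Ioo_subset_Ioo hT₀b le_rfl) hKball
    have hintP : Integrable (fun p : ℝ × EuclideanSpace ℝ (Fin 3) => H (f p.1 p.2))
        (((volume : Measure ℝ).restrict (Ioo T₀ t₁)).prod ((volume : Measure (EuclideanSpace ℝ (Fin 3))).restrict K)) := by
      rw [Measure.prod_restrict]
      exact hintC.mono_set (hsubQ.trans hQ'box)
    rw [intervalIntegral.integral_of_le h01.le, integral_Ioc_eq_integral_Ioo]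
    have eF : ∫ s in Ioo T₀ t₁, mlam s = ∫ p, H (f p.1 p.2)
        ∂(((volume : Measure ℝ).restrict (Ioo T₀ t₁)).prod ((volume : Measure (EuclideanSpace ℝ (Fin 3))).restrict K)) := by
      rw [integral_prod _ hintP]
      exact setIntegral_congr_fun measurableSet_Ioo fun s _ => hmlam s
    rw [eF, Measure.prod_restrict]
    exact setIntegral_mono_set (hintC.mono_set hQ'box) (ae_of_all _ fun p => hH0 _) (ae_of_all _ hsubQ)
  -- (c) combine
  have hℛ0 : 0 ≤ ∫ s in T₀..t₁, ((18 * B ^ 2 + 1728 * B ^ 4 *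
      (SNormLESNormFDerivOfEqConst ℝ (volume : Measure (EuclideanSpace ℝ (Fin 3))) 2 : ℝ) ^ 6 * wbar ^ 2 +
      2 * Q) * χ s + |deriv χ s|) * mlam s := by
    refine intervalIntegral.integral_nonneg h01.le fun s _ => mul_nonneg ?_ ?_
    · exact add_nonneg (mul_nonneg hC0 (hχ01 s).1) (abs_nonneg _)
    · rw [hmlam]; exact setIntegral_nonneg hKc.measurableSet fun x _ => hH0 _
  exact hlow.trans (h103.trans (tenThirds_rhs_pack _ hℛ0 hℛle))

end Core

end

end Summit.NavierStokesRegularity.NavierStokesRegularity.Theorems.SwirlFreeBudget
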